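import Summits.ValiantsHypothesis.ValiantsHypothesis.Theorems.NewtonUnitEquationsTwoProductsMomentRecordDefs

/-!
# R12 lift toolkit — weights, tameness and top congruences

(1/5) Generic bookkeeping on `MvPolynomial σ ℂ` for a real LINEAR weight `lw κ e = Σ_v e_v κ_v`: order `HasOrd` and degree congruence `DegEq`; TAMENESS `Tame κ c P` (every monomial has weight `≤ −c·deg`); TOP CONGRUENCE `TopEq κ w₀ P Q` (equal coefficients at and above the level `w₀`), a congruence for `+`, `•` and — between tame polynomials — for `*`; a monomial of weight exactly `w₀` times a tame `V` is top-congruent to itself times `V(0)`.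
Helper on crux `stmt-ValiantsHypothesis-5906` (line `relation_ladder`, R12 «moment record law», crit-8 g2's texts ✓ `…MomentRecordDefs` / `…MomentRecordRungDefs`); `--supports`, closes nothing by itself: (A∘) `MomentRecordLawUsed`, the rung (B), `PlanarCellBound` and the crux stay OPEN; VP ≠ VNP is NOT proved.  No instances, no notation, no named facts. [folklore]
-/

set_option linter.dupNamespace false

noncomputable section

open Classical

namespace Summit.ValiantsHypothesis.ValiantsHypothesis.Theorems.NewtonUnitEquations.TwoProducts.MomentRecord.Lift
open scoped BigOperators
open MvPolynomial

section Transfer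

variable {σ : Type*}

/-! ## Order and degree congruences -/

/-- `P` has ORDER at least `a`: every monomial of `P` has total degree `≥ a`. [folklore] -/
def HasOrd (a : ℕ) (P : MvPolynomial σ ℂ) : Prop := ∀ e ∈ P.support, a ≤ e.degree

/-- Equal coefficients in total degree `≤ R`. [folklore] -/
def DegEq (R : ℕ) (P Q : MvPolynomial σ ℂ) : Prop := ∀ e : σ →₀ ℕ, e.degree ≤ R → coeff e P = coeff e Q

section Deg

/-- Everything has order `≥ 0`. [folklore] -/
theorem hasOrd_zero (P : MvPolynomial σ ℂ) : HasOrd 0 P := fun _ _ => Nat.zero_le _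

/-- Orders add under multiplication. [folklore] -/
theorem HasOrd.mul {a b : ℕ} {P Q : MvPolynomial σ ℂ} (hP : HasOrd a P) (hQ : HasOrd b Q) : HasOrd (a + b) (P * Q) := by
  classical
  intro e he
  obtain ⟨p, hp, q, hq, rfl⟩ := Finset.mem_add.1 (support_mul P Q he)
  rw [map_add]
  exact add_le_add (hP p hp) (hQ q hq)

/-- Order is preserved by sums. [folklore] -/
theorem HasOrd.add {a : ℕ} {P Q : MvPolynomial σ ℂ} (hP : HasOrd a P) (hQ : HasOrd a Q) : HasOrd a (P + Q) := by
  intro e he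
  rcases Finset.mem_union.1 (support_add he) with h | h
  · exact hP e h
  · exact hQ e h

/-- Order is preserved by negation. [folklore] -/
theorem HasOrd.neg {a : ℕ} {P : MvPolynomial σ ℂ} (hP : HasOrd a P) : HasOrd a (-P) :=
  fun e he => hP e (by rwa [support_neg] at he)

/-- Order is preserved by differences. [folklore] -/
theorem HasOrd.sub {a : ℕ} {P Q : MvPolynomial σ ℂ} (hP : HasOrd a P) (hQ : HasOrd a Q) : HasOrd a (P - Q) := by
  rw [sub_eq_add_neg]; exact hP.add hQ.neg

/-- A polynomial without constant term has order `≥ 1`. [folklore] -/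
theorem hasOrd_one_of_coeff_zero {P : MvPolynomial σ ℂ} (h : coeff 0 P = 0) : HasOrd 1 P := by
  intro e he
  rw [Nat.one_le_iff_ne_zero, Ne, Finsupp.degree_eq_zero_iff]
  rintro rfl
  exact (mem_support_iff.1 he) h

/-- Powers: order `≥ 1` gives order `≥ k` for the `k`-th power. [folklore] -/
theorem HasOrd.pow {P : MvPolynomial σ ℂ} (h : HasOrd 1 P) (k : ℕ) : HasOrd k (P ^ k) := by
  induction k with
  | zero => exact hasOrd_zero _
  | succ k ih => rw [pow_succ]; exact ih.mul h

/-- Reflexivity. [folklore] -/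
theorem degEq_refl {R : ℕ} (P : MvPolynomial σ ℂ) : DegEq R P P := fun _ _ => rfl

/-- Symmetry. [folklore] -/
theorem DegEq.symm {R : ℕ} {P Q : MvPolynomial σ ℂ} (h : DegEq R P Q) : DegEq R Q P := fun e he => (h e he).symm

/-- Transitivity. [folklore] -/
theorem DegEq.trans {R : ℕ} {P Q T : MvPolynomial σ ℂ} (h : DegEq R P Q) (h' : DegEq R Q T) : DegEq R P T :=
  fun e he => (h e he).trans (h' e he)

/-- A difference of order `> R` is a degree congruence. [folklore] -/
theorem degEq_of_hasOrd {R : ℕ} {P Q : MvPolynomial σ ℂ} (h : HasOrd (R + 1) (P - Q)) : DegEq R P Q := by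
  intro e he
  by_contra hne
  have hmem : e ∈ (P - Q).support := by
    rw [mem_support_iff, coeff_sub]; exact sub_ne_zero.2 hne
  have := h e hmem
  omega

/-- Conversely, a degree congruence is a difference of order `> R`. [folklore] -/
theorem DegEq.hasOrd {R : ℕ} {P Q : MvPolynomial σ ℂ} (h : DegEq R P Q) : HasOrd (R + 1) (P - Q) := by
  intro e he
  by_contra hlt
  push Not at hlt
  have := h e (by omega)
  rw [mem_support_iff, coeff_sub, this, sub_self] at he
  exact he rfl

/-- Degree congruences multiply on the left. [folklore] -/
theorem DegEq.mul_left {R : ℕ} {P Q : MvPolynomial σ ℂ} (h : DegEq R P Q) (T : MvPolynomial σ ℂ) :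
    DegEq R (T * P) (T * Q) := by
  refine degEq_of_hasOrd ?_
  rw [← mul_sub]
  simpa using (hasOrd_zero T).mul h.hasOrd

/-- Degree congruences multiply on the right. [folklore] -/
theorem DegEq.mul_right {R : ℕ} {P Q : MvPolynomial σ ℂ} (h : DegEq R P Q) (T : MvPolynomial σ ℂ) :
    DegEq R (P * T) (Q * T) := by
  rw [mul_comm P, mul_comm Q]; exact h.mul_left T

/-- Sums. [folklore] -/
theorem DegEq.add {R : ℕ} {P P' Q Q' : MvPolynomial σ ℂ} (h : DegEq R P P') (h' : DegEq R Q Q') :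
    DegEq R (P + Q) (P' + Q') := fun e he => by rw [coeff_add, coeff_add, h e he, h' e he]

/-- Differences. [folklore] -/
theorem DegEq.sub {R : ℕ} {P P' Q Q' : MvPolynomial σ ℂ} (h : DegEq R P P') (h' : DegEq R Q Q') :
    DegEq R (P - Q) (P' - Q') := fun e he => by rw [coeff_sub, coeff_sub, h e he, h' e he]

end Deg

variable [Fintype σ]

/-! ## Linear weights -/

/-- The linear weight `Σ_v e_v κ_v` of an exponent. [folklore] -/
def lw (κ : σ → ℝ) (e : σ →₀ ℕ) : ℝ := ∑ v, (e v : ℝ) * κ v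

/-- Additivity of the linear weight. [folklore] -/
theorem lw_add (κ : σ → ℝ) (e e' : σ →₀ ℕ) : lw κ (e + e') = lw κ e + lw κ e' := by
  simp only [lw, Finsupp.add_apply, Nat.cast_add, add_mul, Finset.sum_add_distrib]

/-- The zero exponent has weight `0`. [folklore] -/
theorem lw_zero (κ : σ → ℝ) : lw κ 0 = 0 := by simp [lw]

/-- Weight of a single letter taken `k` times. [folklore] -/
theorem lw_single (κ : σ → ℝ) (v : σ) (k : ℕ) : lw κ (Finsupp.single v k) = (k : ℝ) * κ v := by
  classical
  unfold lw
  rw [Finset.sum_eq_single v (fun w _ hw => by simp [Ne.symm hw]) (by simp)]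
  simp

/-- Weight of a multiple. [folklore] -/
theorem lw_nsmul (κ : σ → ℝ) (k : ℕ) (e : σ →₀ ℕ) : lw κ (k • e) = (k : ℝ) * lw κ e := by
  simp only [lw, Finsupp.smul_apply, smul_eq_mul, Nat.cast_mul, Finset.mul_sum, mul_assoc]

/-! ## Tameness -/

/-- `P` is `c`-TAME for `κ`: every monomial `e` of `P` has weight `≤ −c · deg e`. [folklore] -/
def Tame (κ : σ → ℝ) (c : ℝ) (P : MvPolynomial σ ℂ) : Prop :=
  ∀ e ∈ P.support, lw κ e ≤ -c * (e.degree : ℝ)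

section Tame
variable {κ : σ → ℝ} {c : ℝ}

/-- `0` is tame. [folklore] -/
theorem tame_zero : Tame κ c (0 : MvPolynomial σ ℂ) := fun e he => by simp at he

/-- Constants are tame. [folklore] -/
theorem tame_C (a : ℂ) : Tame κ c (C a : MvPolynomial σ ℂ) := by
  intro e he
  classical
  rw [← monomial_zero', support_monomial] at he
  split_ifs at he with h
  · simp at he
  · rw [Finset.mem_singleton] at he
    subst he
    simp [lw_zero]

/-- `1` is tame. [folklore] -/
theorem tame_one : Tame κ c (1 : MvPolynomial σ ℂ) := by
  rw [← C_1]; exact tame_C 1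

/-- A monomial is tame when its exponent satisfies the weight bound. [folklore] -/
theorem tame_monomial {e : σ →₀ ℕ} (he : lw κ e ≤ -c * (e.degree : ℝ)) (a : ℂ) : Tame κ c (monomial e a) := by
  classical
  intro e' he'
  rw [support_monomial] at he'
  split_ifs at he' with h
  · simp at he'
  · rw [Finset.mem_singleton] at he'
    subst he'
    exact he

/-- Tameness is preserved by sums. [folklore] -/
theorem Tame.add {P Q : MvPolynomial σ ℂ} (hP : Tame κ c P) (hQ : Tame κ c Q) : Tame κ c (P + Q) := by
  intro e he
  rcases Finset.mem_union.1 (support_add he) with h | h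
  · exact hP e h
  · exact hQ e h

/-- Tameness is preserved by negation. [folklore] -/
theorem Tame.neg {P : MvPolynomial σ ℂ} (hP : Tame κ c P) : Tame κ c (-P) :=
  fun e he => hP e (by rwa [support_neg] at he)

/-- Tameness is preserved by differences. [folklore] -/
theorem Tame.sub {P Q : MvPolynomial σ ℂ} (hP : Tame κ c P) (hQ : Tame κ c Q) : Tame κ c (P - Q) := by
  rw [sub_eq_add_neg]; exact hP.add hQ.neg

/-- Tameness is preserved by scalars. [folklore] -/
theorem Tame.smul {P : MvPolynomial σ ℂ} (hP : Tame κ c P) (a : ℂ) : Tame κ c (a • P) :=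
  fun e he => hP e (support_smul he)

/-- Tameness is preserved by finite sums. [folklore] -/
theorem tame_sum {ι : Type*} (s : Finset ι) (f : ι → MvPolynomial σ ℂ) (h : ∀ i ∈ s, Tame κ c (f i)) :
    Tame κ c (∑ i ∈ s, f i) := by
  classical
  induction s using Finset.induction_on with
  | empty => rw [Finset.sum_empty]; exact tame_zero
  | insert i s hi ih =>
    rw [Finset.sum_insert hi]
    exact (h i (Finset.mem_insert_self i s)).add (ih fun j hj => h j (Finset.mem_insert_of_mem hj))

/-- Tameness is preserved by products (weights and degrees add). [folklore] -/
theorem Tame.mul {P Q : MvPolynomial σ ℂ} (hP : Tame κ c P) (hQ : Tame κ c Q) : Tame κ c (P * Q) := by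
  classical
  intro e he
  obtain ⟨p, hp, q, hq, rfl⟩ := Finset.mem_add.1 (support_mul P Q he)
  rw [lw_add, map_add, Nat.cast_add, mul_add]
  exact add_le_add (hP p hp) (hQ q hq)

/-- Tameness is preserved by powers. [folklore] -/
theorem Tame.pow {P : MvPolynomial σ ℂ} (hP : Tame κ c P) (k : ℕ) : Tame κ c (P ^ k) := by
  induction k with
  | zero => rw [pow_zero]; exact tame_one
  | succ k ih => rw [pow_succ]; exact ih.mul hP

/-- Tameness is preserved by finite products. [folklore] -/
theorem tame_prod {ι : Type*} (s : Finset ι) (f : ι → MvPolynomial σ ℂ) (h : ∀ i ∈ s, Tame κ c (f i)) :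
    Tame κ c (∏ i ∈ s, f i) := by
  classical
  induction s using Finset.induction_on with
  | empty => rw [Finset.prod_empty]; exact tame_one
  | insert i s hi ih =>
    rw [Finset.prod_insert hi]
    exact (h i (Finset.mem_insert_self i s)).mul (ih fun j hj => h j (Finset.mem_insert_of_mem hj))

/-- A tame polynomial (`c ≥ 0`) has nonpositive weights on its support. [folklore] -/
theorem Tame.lw_nonpos {P : MvPolynomial σ ℂ} (hP : Tame κ c P) (hc : 0 ≤ c) {e : σ →₀ ℕ} (he : e ∈ P.support) :
    lw κ e ≤ 0 :=
  (hP e he).trans (by nlinarith [(Nat.cast_nonneg (e.degree) : (0 : ℝ) ≤ _)])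

/-- A tame polynomial (`c > 0`) has negative weights on its nonzero support exponents. [folklore] -/
theorem Tame.lw_neg {P : MvPolynomial σ ℂ} (hP : Tame κ c P) (hc : 0 < c) {e : σ →₀ ℕ} (he : e ∈ P.support) (he0 : e ≠ 0) :
    lw κ e < 0 := by
  have hd : (1 : ℝ) ≤ (e.degree : ℝ) := by
    exact_mod_cast Nat.one_le_iff_ne_zero.mpr (mt (Finsupp.degree_eq_zero_iff e).mp he0)
  exact (hP e he).trans_lt (by nlinarith)

/-- A tame polynomial (`c > 0`) has bounded degree at and above a weight level: `c · deg e ≤ −lw e ≤ −w₀`. [folklore] -/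
theorem Tame.degree_le {P : MvPolynomial σ ℂ} (hP : Tame κ c P) (hc : 0 < c) {w₀ : ℝ} {R : ℕ} (hR : -w₀ ≤ c * R)
    {e : σ →₀ ℕ} (he : e ∈ P.support) (hw : w₀ ≤ lw κ e) : e.degree ≤ R := by
  have h1 := hP e he
  have h2 : c * (e.degree : ℝ) ≤ c * R := by linarith
  exact_mod_cast le_of_mul_le_mul_left h2 hc

end Tame

/-! ## Top congruences -/

/-- `P` and `Q` agree AT AND ABOVE the weight level `w₀`. [folklore] -/
def TopEq (κ : σ → ℝ) (w₀ : ℝ) (P Q : MvPolynomial σ ℂ) : Prop :=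
  ∀ e : σ →₀ ℕ, w₀ ≤ lw κ e → coeff e P = coeff e Q

section TopEq
variable {κ : σ → ℝ} {w₀ c : ℝ}

/-- Reflexivity. [folklore] -/
theorem topEq_refl (P : MvPolynomial σ ℂ) : TopEq κ w₀ P P := fun _ _ => rfl

/-- Symmetry. [folklore] -/
theorem TopEq.symm {P Q : MvPolynomial σ ℂ} (h : TopEq κ w₀ P Q) : TopEq κ w₀ Q P := fun e he => (h e he).symm

/-- Transitivity. [folklore] -/
theorem TopEq.trans {P Q T : MvPolynomial σ ℂ} (h : TopEq κ w₀ P Q) (h' : TopEq κ w₀ Q T) : TopEq κ w₀ P T :=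
  fun e he => (h e he).trans (h' e he)

/-- Sums. [folklore] -/
theorem TopEq.add {P P' Q Q' : MvPolynomial σ ℂ} (h : TopEq κ w₀ P P') (h' : TopEq κ w₀ Q Q') :
    TopEq κ w₀ (P + Q) (P' + Q') := fun e he => by rw [coeff_add, coeff_add, h e he, h' e he]

/-- Differences. [folklore] -/
theorem TopEq.sub {P P' Q Q' : MvPolynomial σ ℂ} (h : TopEq κ w₀ P P') (h' : TopEq κ w₀ Q Q') :
    TopEq κ w₀ (P - Q) (P' - Q') := fun e he => by rw [coeff_sub, coeff_sub, h e he, h' e he]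

/-- Scalars. [folklore] -/
theorem TopEq.smul {P P' : MvPolynomial σ ℂ} (h : TopEq κ w₀ P P') (a : ℂ) : TopEq κ w₀ (a • P) (a • P') :=
  fun e he => by rw [coeff_smul, coeff_smul, h e he]

/-- PRODUCTS of tame polynomials respect top congruence: a monomial `e = p + q` at or above `w₀` has both parts at or above
`w₀`, because tame parts have nonpositive weight. [folklore] -/
theorem TopEq.mul {P P' Q Q' : MvPolynomial σ ℂ} (hc : 0 ≤ c) (hP : Tame κ c P) (hP' : Tame κ c P') (hQ : Tame κ c Q)
    (hQ' : Tame κ c Q') (h : TopEq κ w₀ P P') (h' : TopEq κ w₀ Q Q') : TopEq κ w₀ (P * Q) (P' * Q') := by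
  classical
  intro e he
  rw [coeff_mul, coeff_mul]
  refine Finset.sum_congr rfl fun x hx => ?_
  rw [Finset.HasAntidiagonal.mem_antidiagonal] at hx
  have hsplit : lw κ e = lw κ x.1 + lw κ x.2 := by rw [← hx, lw_add]
  by_cases hx1 : x.1 ∈ P.support ∪ P'.support
  · by_cases hx2 : x.2 ∈ Q.support ∪ Q'.support
    · have hp : lw κ x.1 ≤ 0 := by
        rcases Finset.mem_union.1 hx1 with h1 | h1
        · exact hP.lw_nonpos hc h1
        · exact hP'.lw_nonpos hc h1
      have hq : lw κ x.2 ≤ 0 := by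
        rcases Finset.mem_union.1 hx2 with h2 | h2
        · exact hQ.lw_nonpos hc h2
        · exact hQ'.lw_nonpos hc h2
      rw [h x.1 (by linarith), h' x.2 (by linarith)]
    · rw [Finset.mem_union, not_or, notMem_support_iff, notMem_support_iff] at hx2
      rw [hx2.1, hx2.2, mul_zero, mul_zero]
  · rw [Finset.mem_union, not_or, notMem_support_iff, notMem_support_iff] at hx1
    rw [hx1.1, hx1.2, zero_mul, zero_mul]

/-- A monomial of weight exactly `w₀` times a TAME `V` (`c > 0`) is top-congruent to the monomial scaled by `V(0)`:
every other product monomial is strictly lighter. [folklore] -/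
theorem topEq_monomial_mul (hc : 0 < c) {e₀ : σ →₀ ℕ} (he₀ : lw κ e₀ = w₀) (G : ℂ) {V : MvPolynomial σ ℂ}
    (hV : Tame κ c V) : TopEq κ w₀ (monomial e₀ G * V) (monomial e₀ (G * coeff 0 V)) := by
  classical
  intro e he
  rw [coeff_monomial_mul', coeff_monomial]
  by_cases hle : e₀ ≤ e
  · rw [if_pos hle]
    by_cases hmem : e - e₀ ∈ V.support
    · by_cases h0 : e - e₀ = 0
      · have hee : e = e₀ := by
          have := tsub_add_cancel_of_le hle
          rw [h0, zero_add] at this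
          exact this.symm
        subst hee
        rw [h0, if_pos rfl]
      · exfalso
        have hneg := hV.lw_neg hc hmem h0
        have : lw κ e = lw κ e₀ + lw κ (e - e₀) := by
          rw [← lw_add, add_tsub_cancel_of_le hle]
        linarith
    · rw [notMem_support_iff] at hmem
      rw [hmem, mul_zero]
      split_ifs with h
      · subst h
        rw [tsub_self] at hmem
        rw [hmem, mul_zero]
      · rfl
  · rw [if_neg hle, if_neg]
    rintro rfl
    exact hle le_rfl

/-- Special case `V(0) = 1`. [folklore] -/
theorem topEq_monomial_mul_of_coeff_zero_eq_one (hc : 0 < c) {e₀ : σ →₀ ℕ} (he₀ : lw κ e₀ = w₀) (G : ℂ)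
    {V : MvPolynomial σ ℂ} (hV : Tame κ c V) (hV0 : coeff 0 V = 1) :
    TopEq κ w₀ (monomial e₀ G * V) (monomial e₀ G) := by
  have h := topEq_monomial_mul hc he₀ G hV
  rwa [hV0, mul_one] at h

/-- Special case `V(0) = 0`. [folklore] -/
theorem topEq_monomial_mul_of_coeff_zero_eq_zero (hc : 0 < c) {e₀ : σ →₀ ℕ} (he₀ : lw κ e₀ = w₀) (G : ℂ)
    {V : MvPolynomial σ ℂ} (hV : Tame κ c V) (hV0 : coeff 0 V = 0) :
    TopEq κ w₀ (monomial e₀ G * V) 0 := by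
  have h := topEq_monomial_mul hc he₀ G hV
  rwa [hV0, mul_zero, monomial_zero] at h

end TopEq

end Transfer

end Summit.ValiantsHypothesis.ValiantsHypothesis.Theorems.NewtonUnitEquations.TwoProducts.MomentRecord.Lift

end
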